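import Mathlib
import Summits.ValiantsHypothesis.ValiantsHypothesis.Theorems.NewtonUnitEquationsTwoProductsReduction

/-!
# Crux `TwoProducts` (stmt-ValiantsHypothesis-5906): pencils of ARITHMETIC-PROGRESSION trinomials are polynomial

The crux `TwoProducts` (`#vert Newt(∏_{j<m} f_j − ∏_{j<m} g_j) ≤ 2^(a m)·(t+2)^b` for `t`-sparse factors) is open for
`t ≥ 3`; the tree's unconditional end-to-end families are the binomial one (`t ≤ 2`,
`TwoProducts.Reduction.twoProducts_sparsity_le_two`: `≤ 72 (m+1)²`) and the common-shape trinomials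
(`twoProducts_commonShape`).  This file adds a second `t = 3` family, the one the crux docstring names as the
danger zone ("KPTT Example 3's digit grids hold `t^(m/3)` convexly independent candidates and two cleverly signed
products might carve them"):

* `twoProducts_apTrinomial` — if every factor `f_j`, `g_j` is supported on a three-term ARITHMETIC PROGRESSION
  `{a_j, a_j + d_j, a_j + 2 d_j}` (its own base point and step; arbitrary complex coefficients, degenerate steps and
  missing terms allowed) — in particular every DIGIT factor `c X^{a}(1 + α X^{d} + β X^{2d})`, the factors of the
  base-3 digit grids — then `#vert Newt(∏ f − ∏ g) ≤ 72 (2m+1)²`.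

The proof is one line of algebra (`exists_mul_of_support_subset_ap`): over `ℂ` a polynomial `c₀ + c₁ Y + c₂ Y²`
in `Y = X^d` factors as `c₀ (1 + ρ₁ Y)(1 + ρ₂ Y)` (`ρ₁ + ρ₂ = c₁/c₀`, `ρ₁ ρ₂ = c₂/c₀`, a square root in `ℂ`), so a
pencil of `m` AP-trinomials is a pencil of `2m` binomials and `twoProducts_sparsity_le_two` applies.  Consequence
for the line `FrameRungTwo` of this crux dir (open stub `stub_crossCancelCount`, algebra-free core "(SD)": two
dissociated frames `A, B` with `#vert conv(S_A ∆ S_B)` polynomial): at `k = 2` every pair of frames whose letter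
triples are arithmetic progressions (all standard 2-D digit / mixed-radix frames `u_j·{0,1,2}`) obeys the polynomial
bound — a counterexample to (SD) must use NON-collinear or unevenly spaced letter triples.  Honest scope: a
special family of the crux at `k = 2`; nothing here bears on the general crux or on `VP ≠ VNP`.
[ours; setting KPTT arXiv:1308.2286 §5, Example 3]
-/

set_option linter.dupNamespace false

namespace Summit.ValiantsHypothesis.ValiantsHypothesis.Theorems.TwoProducts.APTrinomial

open MvPolynomial
open scoped BigOperators

/-- **Binomial factorization of an AP-trinomial.**  A bivariate polynomial supported on a three-term arithmetic
progression `{a, a + d, a + 2d}` is a product of two polynomials with at most two monomials each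
(`c₀ X^a (1 + ρ₁ X^d)(1 + ρ₂ X^d)` with `ρ₁ + ρ₂ = c₁/c₀`, `ρ₁ρ₂ = c₂/c₀`; degenerate cases by hand). [folklore] -/
theorem exists_mul_of_support_subset_ap (f : MvPolynomial (Fin 2) ℂ) (a d : Fin 2 →₀ ℕ)
    (hf : f.support ⊆ {a, a + d, a + 2 • d}) :
    ∃ b₁ b₂ : MvPolynomial (Fin 2) ℂ, b₁.support.card ≤ 2 ∧ b₂.support.card ≤ 2 ∧ f = b₁ * b₂ := by
  classical
  -- supports of the building blocks
  have hmon : ∀ (e : Fin 2 →₀ ℕ) (c : ℂ), (monomial e c).support.card ≤ 1 := fun e c =>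
    (Finset.card_le_card support_monomial_subset).trans (by simp)
  have hone : (1 : MvPolynomial (Fin 2) ℂ).support.card ≤ 1 := by
    rw [← C_1, C_apply]; exact hmon 0 1
  have hbin : ∀ p q : MvPolynomial (Fin 2) ℂ, p.support.card ≤ 1 → q.support.card ≤ 1 →
      (p + q).support.card ≤ 2 := fun p q hp hq =>
    calc (p + q).support.card ≤ (p.support ∪ q.support).card := Finset.card_le_card support_add
      _ ≤ p.support.card + q.support.card := Finset.card_union_le _ _
      _ ≤ 1 + 1 := Nat.add_le_add hp hq
  by_cases hd : d = 0
  · -- degenerate progression: `f` is a monomial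
    subst hd
    have hs : f.support ⊆ {a} := by simpa using hf
    exact ⟨f, 1, (Finset.card_le_card hs).trans (by simp), hone.trans (by norm_num), (mul_one f).symm⟩
  -- the three points of the progression are distinct
  have h01 : a ≠ a + d := fun h => hd (by simpa using h.symm)
  have h12 : a + d ≠ a + 2 • d := fun h => hd (by
    have : a + d + d = a + d + 0 := by rw [add_zero, add_assoc, ← two_nsmul]; exact h.symm
    exact add_left_cancel this)
  have h02 : a ≠ a + 2 • d := fun h => by
    have h' : a + 2 • d = a + 0 := by rw [add_zero]; exact h.symm
    have := add_left_cancel h'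
    exact hd (by simpa [two_nsmul] using this)
  -- expand `f` over the progression
  set c₀ := coeff a f with hc₀
  set c₁ := coeff (a + d) f with hc₁
  set c₂ := coeff (a + 2 • d) f with hc₂
  have hfexp : f = monomial a c₀ + monomial (a + d) c₁ + monomial (a + 2 • d) c₂ := by
    have h1 : f = ∑ e ∈ ({a, a + d, a + 2 • d} : Finset (Fin 2 →₀ ℕ)), monomial e (coeff e f) := by
      conv_lhs => rw [f.as_sum]
      exact Finset.sum_subset hf (fun e _ he => by rw [notMem_support_iff.1 he, monomial_zero])
    rw [h1, Finset.sum_insert (by simp [h01, h02]), Finset.sum_insert (by simp [h12]), Finset.sum_singleton,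
      add_assoc]
  by_cases hc : c₀ = 0
  · -- no bottom term: `f = X^{a+d} · (c₁ + c₂ X^d)`
    refine ⟨monomial (a + d) 1, C c₁ + monomial d c₂, (hmon _ _).trans (by norm_num), ?_, ?_⟩
    · exact hbin _ _ (by rw [C_apply]; exact hmon _ _) (hmon _ _)
    · rw [hfexp, hc, monomial_zero, zero_add, mul_add, C_apply, monomial_mul, monomial_mul, add_zero, one_mul,
        one_mul, add_assoc a d d, two_nsmul]
  · -- generic: square root in `ℂ`, `f = c₀ X^a (1 + ρ₁ X^d)(1 + ρ₂ X^d)`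
    obtain ⟨r, hr⟩ := IsAlgClosed.exists_eq_mul_self ((c₁ / c₀) ^ 2 - 4 * (c₂ / c₀))
    set ρ₁ := (c₁ / c₀ + r) / 2 with hρ₁
    set ρ₂ := (c₁ / c₀ - r) / 2 with hρ₂
    have hsum : c₀ * (ρ₁ + ρ₂) = c₁ := by
      rw [hρ₁, hρ₂]; field_simp; ring
    have hprod : c₀ * (ρ₁ * ρ₂) = c₂ := by
      have : ρ₁ * ρ₂ = c₂ / c₀ := by
        rw [hρ₁, hρ₂]
        have : ((c₁ / c₀ + r) / 2) * ((c₁ / c₀ - r) / 2) = ((c₁ / c₀) ^ 2 - r * r) / 4 := by ring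
        rw [this, ← hr]; ring
      rw [this]; field_simp
    have hb₁ : monomial a c₀ * (1 + monomial d ρ₁) = monomial a c₀ + monomial (a + d) (c₀ * ρ₁) := by
      rw [mul_add, mul_one, monomial_mul]
    refine ⟨monomial a c₀ * (1 + monomial d ρ₁), 1 + monomial d ρ₂, ?_, hbin _ _ hone (hmon _ _), ?_⟩
    · rw [hb₁]; exact hbin _ _ (hmon _ _) (hmon _ _)
    · have e1 : monomial (a + d) c₁ = monomial a c₀ * (monomial d ρ₁ + monomial d ρ₂) := by
        rw [← map_add, monomial_mul, hsum]
      have e2 : monomial (a + 2 • d) c₂ = monomial a c₀ * (monomial d ρ₁ * monomial d ρ₂) := by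
        rw [monomial_mul, monomial_mul, ← add_assoc, add_assoc a d d, ← two_nsmul, hprod]
      rw [hfexp, e1, e2]
      ring

/-- Re-indexing a product over `Fin m × Fin 2` as a product over `Fin (m * 2)`. [folklore] -/
theorem prod_pair_eq {m : ℕ} (b₁ b₂ : Fin m → MvPolynomial (Fin 2) ℂ) :
    ∏ i : Fin (m * 2), ![b₁ (finProdFinEquiv.symm i).1, b₂ (finProdFinEquiv.symm i).1] (finProdFinEquiv.symm i).2
      = ∏ j, (b₁ j * b₂ j) := by
  rw [Fintype.prod_equiv finProdFinEquiv.symm _ (fun q : Fin m × Fin 2 => ![b₁ q.1, b₂ q.1] q.2) (fun i => rfl),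
    Fintype.prod_prod_type]
  refine Finset.prod_congr rfl fun j _ => ?_
  rw [Fin.prod_univ_two]
  simp

/-- Each re-indexed factor is one of the binomials. [folklore] -/
theorem pair_sparsity {m : ℕ} (b₁ b₂ : Fin m → MvPolynomial (Fin 2) ℂ) (h₁ : ∀ j, (b₁ j).support.card ≤ 2)
    (h₂ : ∀ j, (b₂ j).support.card ≤ 2) (i : Fin (m * 2)) :
    (![b₁ (finProdFinEquiv.symm i).1, b₂ (finProdFinEquiv.symm i).1] (finProdFinEquiv.symm i).2).support.card ≤ 2 := by
  have key : ∀ x : Fin 2, x = 0 ∨ x = 1 := by decide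
  rcases key (finProdFinEquiv.symm i).2 with h | h <;> rw [h]
  · exact h₁ _
  · exact h₂ _

/-- **Pencils of AP-trinomials have polynomially many Newton vertices** (crux `TwoProducts`, `k = 2`, an
unconditional `t = 3` family): if every `f_j` and every `g_j` is supported on a three-term arithmetic progression
`{a, a + d, a + 2 • d}` (own base point and step each), then `#vert Newt(∏ f − ∏ g) ≤ 72 (2m + 1)²`.  Each factor is
a product of two binomials (`exists_mul_of_support_subset_ap`), and `twoProducts_sparsity_le_two` applies to the
`2m` binomials. [ours; setting KPTT arXiv:1308.2286 §5, Example 3] -/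
theorem twoProducts_apTrinomial (m : ℕ) (f g : Fin m → MvPolynomial (Fin 2) ℂ)
    (hf : ∀ j, ∃ a d : Fin 2 →₀ ℕ, (f j).support ⊆ {a, a + d, a + 2 • d})
    (hg : ∀ j, ∃ a d : Fin 2 →₀ ℕ, (g j).support ⊆ {a, a + d, a + 2 • d}) :
    (Set.extremePoints ℝ (convexHull ℝ ((fun e : Fin 2 →₀ ℕ => fun i : Fin 2 => ((e i : ℕ) : ℝ)) ''
      ((∏ j, f j - ∏ j, g j).support : Set (Fin 2 →₀ ℕ))))).ncard ≤ 72 * (2 * m + 1) ^ 2 := by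
  choose a d had using hf
  choose a' d' had' using hg
  choose b₁ b₂ hb₁ hb₂ hfb using fun j => exists_mul_of_support_subset_ap (f j) (a j) (d j) (had j)
  choose b₁' b₂' hb₁' hb₂' hgb using fun j => exists_mul_of_support_subset_ap (g j) (a' j) (d' j) (had' j)
  have hF : (∏ j, f j) = ∏ i : Fin (m * 2),
      ![b₁ (finProdFinEquiv.symm i).1, b₂ (finProdFinEquiv.symm i).1] (finProdFinEquiv.symm i).2 := by
    rw [prod_pair_eq]; exact Finset.prod_congr rfl fun j _ => hfb j
  have hG : (∏ j, g j) = ∏ i : Fin (m * 2),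
      ![b₁' (finProdFinEquiv.symm i).1, b₂' (finProdFinEquiv.symm i).1] (finProdFinEquiv.symm i).2 := by
    rw [prod_pair_eq]; exact Finset.prod_congr rfl fun j _ => hgb j
  have h := Summit.ValiantsHypothesis.ValiantsHypothesis.Theorems.TwoProducts.Reduction.twoProducts_sparsity_le_two
    (m * 2) 2 _ _ le_rfl (pair_sparsity b₁ b₂ hb₁ hb₂) (pair_sparsity b₁' b₂' hb₁' hb₂')
  rw [← hF, ← hG] at h
  calc _ ≤ 72 * (m * 2 + 1) ^ 2 := h
    _ = 72 * (2 * m + 1) ^ 2 := by ring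

end Summit.ValiantsHypothesis.ValiantsHypothesis.Theorems.TwoProducts.APTrinomial
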